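import Summits.QuantumAdvantage.AdviceFreeQNC0.RingRotation
import HarnessLib

/-!
# Cell qa-qnc0 (rung F-Q1, route `RingFrame`, crux α `RingToElim`): low-degree LEADER ELECTION on
# the cycle, I — the election polynomial and the averaging over seeds

Planner qa-qnc0-p2's ROUND-7 ask R7-b (`HOME/qa-qnc0-p2/ROUND-7.md` §2.4, `line/Sketch7.lean` §1b:
`LowDegLeaderElection`, PROPOSITION S).  The planner suggested the in-tree Razborov–Smolensky lemma on
a depth-3 circuit; we give instead a DIRECT polynomial construction (no circuit model), which this
file sets up:

* WINDOWS `lab hn ℓ k x : Fin ℓ → Bool`, the `ℓ` bits of `x` read cyclically from position `k`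
  (`lab_rot`: the windows of `rot b x` are the windows of `x` shifted by `b`);
* the **lexicographic comparison polynomial** `ltPoly hn ℓ k` of degree `≤ ℓ + 1`
  (`ltPoly_mem`) computing EXACTLY `[lab 0 x <_lex lab k x]` (`ltPoly_apply`): the sum over `j` of
  `Π_{i<j}(1 + X_i + Y_i)·(1 + X_j)·Y_j`, the events "first difference at `j`" being disjoint
  (`Pi.Lex` on `Fin ℓ → Bool`);
* Razborov's approximate AND over the `n − 1` nonzero rotations: for a seed `ω : Fin t → (Fin n → Bool)`
  the **election polynomial** `elect hn ℓ t ω = Π_{s<t} (1 + Σ_{k≠0, ω s k} (1 + LT_k))` of degree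
  `≤ t(ℓ+1)` (`elect_mem`); it fires on every GOOD input (window at `0` strictly lex-smallest,
  `elect_apply_of_good`), and on a non-good input it errs iff all `t` parities vanish, which happens
  for exactly a `2^{-t}` fraction of the seeds (`two_mul_card_evenSeeds`: flipping one offending
  position is an involution swapping even and odd subsets; `card_seeds_err`);
* **averaging** (`exists_good_seed`): some seed errs on at most `2ⁿ/2^t` inputs.

Part II (`LeaderElection.lean`) adds the window-collision count and assembles
`lowDegLeaderElection`.  Label: instrument (normal form N-EQ of ROUND-7); WHAT THIS IS NOT: nothing
on α's truth; separation NOT moved.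
-/

noncomputable section

open scoped Classical

namespace Summit.QuantumAdvantage.AdviceFreeQNC0

open Finset
open Literature.Computability.QuantumComplexity Literature.Computability.QuantumComplexity.RingHLF
open Literature.Computability.MetaComplexity Literature.Computability.MetaComplexity.Smolensky

/-! ## Low-degree leader election on the cycle -/

namespace LeaderElection

open RingSymmetry

variable {n : ℕ}

/-! ### Windows (labels) -/

/-- position `j mod n` of the ring. -/
def idx (hn : 0 < n) (j : ℕ) : Fin n := ⟨j % n, Nat.mod_lt _ hn⟩

/-- the length-`ℓ` WINDOW (label) of `x` starting at position `k`: `i ↦ x_{(i+k) mod n}`. -/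
def lab (hn : 0 < n) (ℓ k : ℕ) (x : Fin n → Bool) : Fin ℓ → Bool := fun i => x (idx hn (i.val + k))

/-- `idx` depends only on `j mod n`. -/
theorem idx_eq_of_mod_eq (hn : 0 < n) {j j' : ℕ} (h : j % n = j' % n) : idx hn j = idx hn j' :=
  Fin.ext h

/-- The window starting at `k` depends only on `k mod n`. -/
theorem lab_eq_of_mod_eq (hn : 0 < n) (ℓ : ℕ) {k k' : ℕ} (h : k % n = k' % n) (x : Fin n → Bool) :
    lab hn ℓ k x = lab hn ℓ k' x := by
  funext i
  simp only [lab]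
  rw [idx_eq_of_mod_eq hn (Nat.ModEq.add_left i.val h)]

/-- Windows of a rotated pattern: `lab k (rot b x) = lab (k + b) x`. -/
theorem lab_rot (hn : 0 < n) (ℓ k b : ℕ) (x : Fin n → Bool) :
    lab hn ℓ k (rot b x) = lab hn ℓ (k + b) x := by
  funext i
  simp only [lab, rot_apply, shift, idx]
  congr 1
  apply Fin.ext
  simp only
  rw [Nat.mod_add_mod, Nat.add_assoc]

/-! ### Indicators and the lexicographic comparison polynomial -/

/-- `𝔽₂`-indicator of a Boolean. -/
def ι (b : Bool) : ZMod 2 := if b = true then 1 else 0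

/-- the coordinate function `x ↦ [x_j]` (a degree-`1` monomial). -/
def coord (j : Fin n) : CubeFn (ZMod 2) n := fun x => ι (x j)

/-- `coord j` has degree `≤ 1`. -/
theorem coord_mem (j : Fin n) : coord j ∈ lowDeg (ZMod 2) n 1 := by
  have e : coord j = mono (ZMod 2) ({j} : Finset (Fin n)) := by
    funext x; rw [mono_apply]; simp [coord, ι]
  rw [e]; exact mono_mem_lowDeg (by simp)

/-- the `j`-th term of the comparison polynomial of the windows at `0` and at `k`:
`Π_{i<j} (1 + X_i + Y_i) · (1 + X_j) · Y_j` with `X_i = x_{i}`, `Y_i = x_{i+k}`. -/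
def ltTerm (hn : 0 < n) (ℓ k : ℕ) (j : Fin ℓ) : CubeFn (ZMod 2) n :=
  (∏ i ∈ univ.filter (fun i : Fin ℓ => i < j),
      (1 + coord (idx hn (i.val + 0)) + coord (idx hn (i.val + k)))) *
    (1 + coord (idx hn (j.val + 0))) * coord (idx hn (j.val + k))

/-- **the lexicographic comparison polynomial** `LT_k = Σ_j ltTerm j`: it computes
`[window at 0 <_lex window at k]` EXACTLY (the events "first difference at `j`, and there `0 < 1`"
are pairwise disjoint), in degree `≤ ℓ + 1`. -/
def ltPoly (hn : 0 < n) (ℓ k : ℕ) : CubeFn (ZMod 2) n := ∑ j : Fin ℓ, ltTerm hn ℓ k j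

/-- Degree of a comparison term: `≤ ℓ + 1`. -/
theorem ltTerm_mem (hn : 0 < n) (ℓ k : ℕ) (j : Fin ℓ) :
    ltTerm hn ℓ k j ∈ lowDeg (ZMod 2) n (ℓ + 1) := by
  unfold ltTerm
  have h1 : ∀ i : Fin ℓ, (1 + coord (idx hn (i.val + 0)) + coord (idx hn (i.val + k)) :
      CubeFn (ZMod 2) n) ∈ lowDeg (ZMod 2) n 1 :=
    fun i => Submodule.add_mem _ (Submodule.add_mem _ (one_mem_lowDeg 1) (coord_mem _)) (coord_mem _)
  have hprod := prod_mem_lowDeg (univ.filter fun i : Fin ℓ => i < j) (fun i _ => h1 i)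
  have hcard : (univ.filter fun i : Fin ℓ => i < j).card * 1 ≤ ℓ - 1 := by
    rw [Nat.mul_one]
    calc (univ.filter fun i : Fin ℓ => i < j).card ≤ (univ.filter fun i : Fin ℓ => i ≠ j).card :=
          card_le_card (fun i hi => by
            rw [mem_filter] at hi ⊢; exact ⟨hi.1, ne_of_lt hi.2⟩)
      _ = ℓ - 1 := by
          rw [filter_ne' univ j, card_erase_of_mem (mem_univ _), card_univ, Fintype.card_fin]
  have h2 : (1 + coord (idx hn (j.val + 0)) : CubeFn (ZMod 2) n) ∈ lowDeg (ZMod 2) n 1 :=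
    Submodule.add_mem _ (one_mem_lowDeg 1) (coord_mem _)
  have h3 := mul_mem_lowDeg_add (mul_mem_lowDeg_add (lowDeg_mono hcard hprod) h2) (coord_mem (idx hn (j.val + k)))
  refine lowDeg_mono ?_ h3
  have := j.isLt
  omega

/-- Degree of the comparison polynomial: `≤ ℓ + 1`. -/
theorem ltPoly_mem (hn : 0 < n) (ℓ k : ℕ) : ltPoly hn ℓ k ∈ lowDeg (ZMod 2) n (ℓ + 1) :=
  Submodule.sum_mem _ fun j _ => ltTerm_mem hn ℓ k j

/-- the event "the windows at `0` and `k` first differ at `j`, with `0` there in the first and `1` in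
the second". -/
def FirstDiff {ℓ' : ℕ} (u v : Fin ℓ' → Bool) (j : Fin ℓ') : Prop :=
  (∀ i : Fin ℓ', i < j → u i = v i) ∧ u j = false ∧ v j = true

/-- Value of a comparison term: the indicator of `FirstDiff`. -/
theorem ltTerm_apply (hn : 0 < n) (ℓ k : ℕ) (j : Fin ℓ) (x : Fin n → Bool) :
    ltTerm hn ℓ k j x = if FirstDiff (lab hn ℓ 0 x) (lab hn ℓ k x) j then 1 else 0 := by
  have key : ∀ a b : Bool, (1 + ι a + ι b : ZMod 2) = if a = b then 1 else 0 := by decide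
  have key2 : ∀ a : Bool, (1 + ι a : ZMod 2) = if a = false then 1 else 0 := by decide
  have key3 : ∀ b : Bool, ι b = if b = true then 1 else 0 := by decide
  have hval : ltTerm hn ℓ k j x =
      (∏ i ∈ univ.filter (fun i : Fin ℓ => i < j),
          (if lab hn ℓ 0 x i = lab hn ℓ k x i then (1 : ZMod 2) else 0)) *
        (if lab hn ℓ 0 x j = false then (1 : ZMod 2) else 0) *
        (if lab hn ℓ k x j = true then (1 : ZMod 2) else 0) := by
    unfold ltTerm
    rw [Pi.mul_apply, Pi.mul_apply, Finset.prod_apply]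
    simp only [Pi.add_apply, Pi.one_apply, coord, lab]
    rw [key2, key3]
    congr 1; congr 1
    exact Finset.prod_congr rfl fun i _ => key _ _
  rw [hval, Finset.prod_boole]
  simp only [mem_filter, mem_univ, true_and, FirstDiff]
  by_cases h1 : ∀ i : Fin ℓ, i < j → lab hn ℓ 0 x i = lab hn ℓ k x i <;>
    by_cases h2 : lab hn ℓ 0 x j = false <;>
      by_cases h3 : lab hn ℓ k x j = true <;> simp [h1, h2, h3]

/-- At most one index is the first difference. -/
theorem firstDiff_unique {ℓ' : ℕ} {u v : Fin ℓ' → Bool} {j j' : Fin ℓ'} (h : FirstDiff u v j)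
    (h' : FirstDiff u v j') : j = j' := by
  by_contra hne
  rcases lt_or_gt_of_ne hne with hlt | hlt
  · have := h'.1 j hlt; rw [h.2.1, h.2.2] at this; exact Bool.false_ne_true this
  · have := h.1 j' hlt; rw [h'.2.1, h'.2.2] at this; exact Bool.false_ne_true this

/-- `FirstDiff` at some index is exactly the lexicographic comparison. -/
theorem exists_firstDiff_iff {ℓ' : ℕ} (u v : Fin ℓ' → Bool) :
    (∃ j, FirstDiff u v j) ↔ toLex u < toLex v := by
  show (∃ j, FirstDiff u v j) ↔ Pi.Lex (· < ·) (· < ·) u v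
  simp only [FirstDiff, Pi.Lex, Bool.lt_iff]

/-- In `𝔽₂`, a sum of indicators of pairwise exclusive events is the indicator of their union. -/
theorem sum_ite_eq_ite_exists {ℓ' : ℕ} (Q : Fin ℓ' → Prop) (hQ : ∀ j j', Q j → Q j' → j = j') :
    (∑ j : Fin ℓ', (if Q j then (1 : ZMod 2) else 0)) = if ∃ j, Q j then 1 else 0 := by
  by_cases hex : ∃ j, Q j
  · obtain ⟨j₀, hj₀⟩ := hex
    rw [if_pos ⟨j₀, hj₀⟩, Finset.sum_eq_single j₀]
    · rw [if_pos hj₀]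
    · intro j _ hj; rw [if_neg fun h => hj (hQ j j₀ h hj₀)]
    · intro h; exact absurd (mem_univ _) h
  · rw [if_neg hex]
    exact Finset.sum_eq_zero fun j _ => by rw [if_neg fun h => hex ⟨j, h⟩]

/-- **The comparison polynomial is exact**: `LT_k(x) = [lab 0 x <_lex lab k x]`. -/
theorem ltPoly_apply (hn : 0 < n) (ℓ k : ℕ) (x : Fin n → Bool) :
    ltPoly hn ℓ k x = if toLex (lab hn ℓ 0 x) < toLex (lab hn ℓ k x) then 1 else 0 := by
  unfold ltPoly
  rw [Finset.sum_apply]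
  simp only [ltTerm_apply]
  rw [sum_ite_eq_ite_exists _ (fun j j' h h' => firstDiff_unique h h')]
  simp only [exists_firstDiff_iff]

/-! ### The Razborov product: a probabilistic AND over the `n − 1` other rotations -/

/-- seeds: `t` subsets of the positions (as indicator vectors). -/
abbrev Seed (n t : ℕ) : Type := Fin t → Fin n → Bool

/-- the parity `Σ_{k ≠ 0, σ k} (1 + LT_k)` collected by the subset `σ`. -/
def parity (hn : 0 < n) (ℓ : ℕ) (σ : Fin n → Bool) : CubeFn (ZMod 2) n :=
  ∑ k ∈ univ.filter (fun k : Fin n => k.val ≠ 0 ∧ σ k = true), (1 + ltPoly hn ℓ k.val)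

/-- **the election polynomial** of seed `ω`: `Π_{s<t} (1 + parity (ω s))` — Razborov's
approximate `AND_{k≠0} LT_k`. -/
def elect (hn : 0 < n) (ℓ t : ℕ) (ω : Seed n t) : CubeFn (ZMod 2) n :=
  ∏ s : Fin t, (1 + parity hn ℓ (ω s))

/-- Degree of a parity: `≤ ℓ + 1`. -/
theorem parity_mem (hn : 0 < n) (ℓ : ℕ) (σ : Fin n → Bool) :
    parity hn ℓ σ ∈ lowDeg (ZMod 2) n (ℓ + 1) :=
  Submodule.sum_mem _ fun k _ => Submodule.add_mem _ (one_mem_lowDeg _) (ltPoly_mem hn ℓ k.val)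

/-- **Degree of the election polynomial**: `≤ t·(ℓ+1)`. -/
theorem elect_mem (hn : 0 < n) (ℓ t : ℕ) (ω : Seed n t) :
    elect hn ℓ t ω ∈ lowDeg (ZMod 2) n (t * (ℓ + 1)) := by
  have h := prod_mem_lowDeg (univ : Finset (Fin t))
    (fun s _ => Submodule.add_mem _ (one_mem_lowDeg _) (parity_mem hn ℓ (ω s)))
  rwa [card_univ, Fintype.card_fin] at h

/-- `x` is GOOD: its window at `0` is lexicographically smaller than every other window. -/
def Good (hn : 0 < n) (ℓ : ℕ) (x : Fin n → Bool) : Prop :=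
  ∀ k : Fin n, k.val ≠ 0 → toLex (lab hn ℓ 0 x) < toLex (lab hn ℓ k.val x)

/-- A parity, evaluated: `Σ_k [k ≠ 0 ∧ σ k]·(1 + LT_k(x))`. -/
theorem parity_apply (hn : 0 < n) (ℓ : ℕ) (σ : Fin n → Bool) (x : Fin n → Bool) :
    parity hn ℓ σ x = ∑ k : Fin n, if k.val ≠ 0 ∧ σ k = true then 1 + ltPoly hn ℓ k.val x else 0 := by
  unfold parity
  rw [Finset.sum_apply, Finset.sum_filter]
  rfl

/-- On a good input every parity vanishes (all `LT_k = 1`). -/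
theorem parity_apply_of_good (hn : 0 < n) {ℓ : ℕ} {x : Fin n → Bool} (hx : Good hn ℓ x)
    (σ : Fin n → Bool) : parity hn ℓ σ x = 0 := by
  rw [parity_apply]
  refine Finset.sum_eq_zero fun k _ => ?_
  by_cases hk : k.val ≠ 0 ∧ σ k = true
  · rw [if_pos hk, ltPoly_apply, if_pos (hx k hk.1)]; decide
  · rw [if_neg hk]

/-- `elect ω x = 1` iff every parity vanishes at `x`. -/
theorem elect_apply_eq_one_iff (hn : 0 < n) (ℓ t : ℕ) (ω : Seed n t) (x : Fin n → Bool) :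
    elect hn ℓ t ω x = 1 ↔ ∀ s : Fin t, parity hn ℓ (ω s) x = 0 := by
  unfold elect
  rw [Finset.prod_apply]
  simp only [Pi.add_apply, Pi.one_apply]
  have h1 : ∀ p : ZMod 2, 1 + p = 1 ↔ p = 0 := by decide
  have h01 : ∀ a : ZMod 2, a = 0 ∨ a = 1 := by decide
  constructor
  · intro h s
    by_contra hs
    have h0 : (1 + parity hn ℓ (ω s) x) = 0 := by
      rcases h01 (parity hn ℓ (ω s) x) with h' | h'
      · exact absurd h' hs
      · rw [h']; decide
    rw [Finset.prod_eq_zero (mem_univ s) h0] at h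
    exact zero_ne_one h
  · intro h
    exact Finset.prod_eq_one fun s _ => (h1 _).2 (h s)

/-- On a good input the election polynomial fires, for EVERY seed. -/
theorem elect_apply_of_good (hn : 0 < n) {ℓ : ℕ} (t : ℕ) (ω : Seed n t) {x : Fin n → Bool}
    (hx : Good hn ℓ x) : elect hn ℓ t ω x = 1 :=
  (elect_apply_eq_one_iff hn ℓ t ω x).2 fun s => parity_apply_of_good hn hx (ω s)

/-- the error event: the election polynomial of seed `ω` disagrees with `[Good x]` at `x`. -/
def Err (hn : 0 < n) (ℓ t : ℕ) (ω : Seed n t) (x : Fin n → Bool) : Prop :=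
  elect hn ℓ t ω x ≠ if Good hn ℓ x then 1 else 0

/-- The error event happens only on non-good inputs, and there iff all parities vanish. -/
theorem err_iff (hn : 0 < n) (ℓ t : ℕ) (ω : Seed n t) (x : Fin n → Bool) :
    Err hn ℓ t ω x ↔ ¬ Good hn ℓ x ∧ ∀ s : Fin t, parity hn ℓ (ω s) x = 0 := by
  unfold Err
  by_cases hx : Good hn ℓ x
  · rw [if_pos hx, elect_apply_of_good hn t ω hx]
    simp [hx]
  · rw [if_neg hx, ← elect_apply_eq_one_iff]
    have h01 : ∀ a : ZMod 2, a = 0 ∨ a = 1 := by decide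
    rcases h01 (elect hn ℓ t ω x) with h | h <;> simp [h, hx]

/-- the subsets whose parity vanishes at `x`. -/
def evenSeeds (hn : 0 < n) (ℓ : ℕ) (x : Fin n → Bool) : Finset (Fin n → Bool) :=
  univ.filter fun σ => parity hn ℓ σ x = 0

/-- flipping the membership of one position in a subset. -/
def flipAt (k₀ : Fin n) (σ : Fin n → Bool) : Fin n → Bool := Function.update σ k₀ (!σ k₀)

/-- Flipping twice is the identity. -/
theorem flipAt_flipAt (k₀ : Fin n) (σ : Fin n → Bool) : flipAt k₀ (flipAt k₀ σ) = σ := by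
  funext k
  unfold flipAt
  by_cases hk : k = k₀
  · subst hk; simp
  · simp [Function.update_of_ne hk]

/-- Flipping a position `k₀ ≠ 0` with `LT_{k₀}(x) = 0` changes the parity at `x` by one. -/
theorem parity_flipAt (hn : 0 < n) {ℓ : ℕ} {x : Fin n → Bool} {k₀ : Fin n} (hk₀ : k₀.val ≠ 0)
    (hlt : ltPoly hn ℓ k₀.val x = 0) (σ : Fin n → Bool) :
    parity hn ℓ (flipAt k₀ σ) x = parity hn ℓ σ x + 1 := by
  rw [parity_apply, parity_apply, ← Finset.add_sum_erase _ _ (mem_univ k₀),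
    ← Finset.add_sum_erase _ _ (mem_univ k₀)]
  have hrest : ∑ k ∈ univ.erase k₀,
      (if k.val ≠ 0 ∧ flipAt k₀ σ k = true then 1 + ltPoly hn ℓ k.val x else 0) =
      ∑ k ∈ univ.erase k₀, (if k.val ≠ 0 ∧ σ k = true then 1 + ltPoly hn ℓ k.val x else 0) := by
    refine Finset.sum_congr rfl fun k hk => ?_
    have hne : k ≠ k₀ := (mem_erase.1 hk).1
    simp only [flipAt, Function.update_of_ne hne]
  rw [hrest, hlt, add_zero]
  have hflip : flipAt k₀ σ k₀ = !σ k₀ := by simp [flipAt]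
  rw [hflip]
  have h11 : ∀ R : ZMod 2, 0 + R = 1 + R + 1 := by
    intro R
    have : ∀ a : ZMod 2, 0 + a = 1 + a + 1 := by decide
    exact this R
  cases σ k₀
  · rw [if_pos ⟨hk₀, rfl⟩, if_neg (by simp)]; ring
  · rw [if_neg (by simp), if_pos ⟨hk₀, rfl⟩]; exact h11 _

/-- On a non-good input exactly half of the subsets have vanishing parity. -/
theorem two_mul_card_evenSeeds (hn : 0 < n) {ℓ : ℕ} {x : Fin n → Bool} (hx : ¬ Good hn ℓ x) :
    2 * (evenSeeds hn ℓ x).card = 2 ^ n := by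
  have hx' : ∃ k₀ : Fin n, k₀.val ≠ 0 ∧ ¬ (toLex (lab hn ℓ 0 x) < toLex (lab hn ℓ k₀.val x)) := by
    by_contra h
    exact hx fun k hk => by_contra fun hlt => h ⟨k, hk, hlt⟩
  obtain ⟨k₀, hk₀, hlt⟩ := hx'
  have hlt0 : ltPoly hn ℓ k₀.val x = 0 := by rw [ltPoly_apply, if_neg hlt]
  have h01 : ∀ a : ZMod 2, a = 0 ∨ a = 1 := by decide
  have hodd : (univ.filter fun σ : Fin n → Bool => ¬ parity hn ℓ σ x = 0).card =
      (evenSeeds hn ℓ x).card := by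
    refine card_bij (fun σ _ => flipAt k₀ σ) (fun σ hσ => ?_) (fun σ _ σ' _ h => ?_) (fun σ hσ => ?_)
    · rw [mem_filter] at hσ
      unfold evenSeeds
      rw [mem_filter, parity_flipAt hn hk₀ hlt0]
      refine ⟨mem_univ _, ?_⟩
      rcases h01 (parity hn ℓ σ x) with h | h
      · exact absurd h hσ.2
      · rw [h]; decide
    · have := congrArg (flipAt k₀) h
      rwa [flipAt_flipAt, flipAt_flipAt] at this
    · refine ⟨flipAt k₀ σ, ?_, flipAt_flipAt k₀ σ⟩
      unfold evenSeeds at hσ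
      rw [mem_filter] at hσ ⊢
      refine ⟨mem_univ _, ?_⟩
      rw [parity_flipAt hn hk₀ hlt0, hσ.2]; decide
  have hsum := card_filter_add_card_filter_not (s := (univ : Finset (Fin n → Bool)))
    (fun σ : Fin n → Bool => parity hn ℓ σ x = 0)
  rw [card_univ, Fintype.card_fun, Fintype.card_bool, Fintype.card_fin, hodd] at hsum
  unfold evenSeeds at hsum ⊢
  omega

/-- For a non-good input, the seeds that err at it are exactly a `2^{-t}` fraction. -/
theorem card_seeds_err (hn : 0 < n) (ℓ t : ℕ) {x : Fin n → Bool} (hx : ¬ Good hn ℓ x) :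
    (univ.filter fun ω : Seed n t => Err hn ℓ t ω x).card * 2 ^ t =
      Fintype.card (Seed n t) := by
  have hset : (univ.filter fun ω : Seed n t => Err hn ℓ t ω x) =
      Fintype.piFinset fun _ : Fin t => evenSeeds hn ℓ x := by
    ext ω
    rw [mem_filter, Fintype.mem_piFinset, err_iff]
    simp only [mem_univ, true_and, evenSeeds, mem_filter, hx, not_false_eq_true]
  rw [hset, Fintype.card_piFinset_const, ← mul_pow, mul_comm, two_mul_card_evenSeeds hn hx,
    Fintype.card_pi_const, Fintype.card_fun, Fintype.card_bool, Fintype.card_fin]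

/-- **Averaging over seeds**: some seed errs on at most a `2^{-t}` fraction of the inputs. -/
theorem exists_good_seed (hn : 0 < n) (ℓ t : ℕ) :
    ∃ ω : Seed n t, (univ.filter fun x : Fin n → Bool => Err hn ℓ t ω x).card * 2 ^ t ≤ 2 ^ n := by
  have hΩ : (0 : ℕ) < Fintype.card (Seed n t) := Fintype.card_pos
  have key : ∀ x : Fin n → Bool,
      (univ.filter fun ω : Seed n t => Err hn ℓ t ω x).card * 2 ^ t ≤ Fintype.card (Seed n t) := by
    intro x
    by_cases hx : Good hn ℓ x
    · have h0 : (univ.filter fun ω : Seed n t => Err hn ℓ t ω x) = ∅ := by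
        refine filter_false_of_mem fun ω _ => ?_
        rw [err_iff]; exact fun h => h.1 hx
      rw [h0, card_empty, zero_mul]; exact Nat.zero_le _
    · exact (card_seeds_err hn ℓ t hx).le
  have hswap : ∑ ω : Seed n t, (univ.filter fun x : Fin n → Bool => Err hn ℓ t ω x).card =
      ∑ x : Fin n → Bool, (univ.filter fun ω : Seed n t => Err hn ℓ t ω x).card := by
    simp only [card_filter]
    exact Finset.sum_comm
  have htot : ∑ ω : Seed n t, (univ.filter fun x : Fin n → Bool => Err hn ℓ t ω x).card * 2 ^ t ≤
      ∑ _ω : Seed n t, 2 ^ n := by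
    rw [← Finset.sum_mul, hswap, Finset.sum_mul]
    calc ∑ x : Fin n → Bool, (univ.filter fun ω : Seed n t => Err hn ℓ t ω x).card * 2 ^ t
        ≤ ∑ _x : Fin n → Bool, Fintype.card (Seed n t) := sum_le_sum fun x _ => key x
      _ = ∑ _ω : Seed n t, 2 ^ n := by
          rw [sum_const, sum_const, card_univ, card_univ, smul_eq_mul, smul_eq_mul,
            Fintype.card_fun, Fintype.card_bool, Fintype.card_fin, mul_comm]
  obtain ⟨ω, _, hω⟩ := exists_le_of_sum_le (univ_nonempty (α := Seed n t)) htot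
  exact ⟨ω, hω⟩

end LeaderElection

end Summit.QuantumAdvantage.AdviceFreeQNC0
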